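import Literature.MathematicalPhysics.QuantumFieldTheory.Balaban1983to89.B12SmallFieldDomain259

/-!
# `Balaban1983to89.B12B0Restriction267` — [Balaban1987RG1] p. 266–267: «The above restrictions imply also
restrictions on B′(b₀(c)), with the constant ε₁ replaced by O(ε₁), because these variables can be expressed in terms
of the remaining ones» — PROVED at the LINEAR level of p. 268 («using the δ-function δ(Q̃B′) we eliminate the
variables B′(b₀(c))»): on the constraint surface `LQ̃B′ = 0` of a local linear `LQ̃` whose corridor coefficients are
boundedly invertible (p. 267: «h(c) … an inverse of a coefficient at the variable B′(b₀(c)) in (Q̃B′)(c)»), every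
eliminated variable is bounded by `O(1)·ε₁` once the remaining ones are `< ε₁`

HONEST FRAMING (cell `lit-balaban`, verbatim): statement-level skeleton of published theorems with citation tags;
proofs where landed; nothing here is a claim about the Yang–Mills mass gap.

CITATION HEADER.  T. Bałaban, *Renormalization group approach to lattice gauge field theories. I. Generation of
effective actions in a small field approximation and a coupling constant renormalization in four dimensions*,
Commun. Math. Phys. **109** (1987) 249–301, doi:10.1007/bf01215223 [Balaban1987RG1] (cell paper B12; held text
`paper:balaban1987-cmp109-rg-i-small-field`, journal page = PDF page + 248; pp. 266–268 [PDF 18–20] re-read for this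
module).  Unit `lit-balaban-r09` gen 10 (reader/typer of CMP 109), SKELETON rows `B12.Eq2.9` (the rider after (2.9)),
`B12.Def@267` (the operator `h`), `B12.Eq2.11` («eliminate the variables B′(b₀(c))», «B′ = CB»).

WHAT IS PRINTED (verbatim).  p. 266–267 [PDF 18–19], after (2.9): *«The above restrictions imply also restrictions on
B′(b₀(c)), with the constant ε₁ replaced by O(ε₁), because these variables can be expressed in terms of the
remaining ones as in the first step. This we will discuss in detail.»*  p. 267: *«Furthermore, the operator h
satisfies the identity LQ̃h = I on T⁽ᵏ⁺¹⁾. Of course h is uniquely defined by these conditions, in fact it is a very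
simple operator given by the equality (hB)(b₀(c)) = h(c)B(c), where h(c) is a linear operator on the Lie algebra 𝐠,
equal to an inverse of a coefficient at the variable B′(b₀(c)) in (Q̃B′)(c), multiplied by L⁻¹.»*  p. 267 last
line – p. 268: *«We perform the same operation as in the first step, namely using the δ-functions δ(Q̃B′) we
eliminate the variables B′(b₀(c)), c ∈ T⁽ᵏ⁺¹⁾. Denoting the remaining variables by B we have B′ = CB, C is the
operator determined by the configuration V⁽ᵏ⁾ …»*  ([B7] = [Balaban1985Averaging] Prop. 4 p. 38, quoted in
`B13CorridorSeparation`: the averaging function at `c` depends on the field restricted to `B(c₋) ∪ B(c₊)`.)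

THE TYPING (located reading; nothing of the nonlinear elimination is claimed).  The rider is proved for the LINEARIZED
constraint `LQ̃B′ = 0` (the linear part `LQ̃` of (2.4), p. 267 «LQ̃B′ + C̃(B′)», after the change of variables of
p. 267 the constraint IS `δ(LQ̃B)`; the nonlinear version «as in the first step» would add the fixed-point argument of
[15] Sect. C, tree `B12Lineariz267`/`B13PkLocalTerms`, not repeated here).  § 1 is CARRIER-AGNOSTIC (fine bonds `β`,
coarse bonds `C`, distinguished bonds `b₀ : C → β`, dependence sets `N : C → Set β`, exactly the data of the abstract
model `B13PkLocalTerms.hOp`/`isLocalIn_fpMap`), so that both the cell's Setup geometry (§ 2: `B12SmallFieldDomain259.b0`,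
`nbhd`, separation `eq_of_b0_mem_nbhd`) and the ℤᵈ lineage (`B13CorridorSeparation.b0Z`) can instantiate it.  The
three structural inputs are hypotheses with print's names: (L) LOCALITY WITH A BOUND — `‖(LQ̃B)(c)‖ ≤ K·M` whenever
`‖B(b)‖ ≤ M` on `N(c)` ([B7] Prop. 4 + (126); implies plain locality, `isLocal_of_bound`); (H) the corridor
coefficient `X ↦ (LQ̃ δ_{b₀(c)}X)(c)` is BOUNDED BELOW, `‖X‖ ≤ H·‖coeff_c X‖` (p. 267: it is invertible, `h(c)` = `L⁻¹·`
its inverse; for the main term `L^{1−d}Ad_{g(c)}` of `B12HOperator267`, `H = L^{d−1}`); (S) SEPARATION — no foreign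
`b₀(c′)` lies in `N(c)` (PROVED for the Setup geometry: `B12SmallFieldDomain259.eq_of_b0_mem_nbhd`).  Print's `O(1)`
↦ `H·K`.  NOT DISCHARGED here: (L)/(H) for [I]'s actual `LQ̃` (the lineage `B12AverageCorridor267`/`B12Average012Analytic`
has the corridor coefficient and linearity, not yet the operator bound `K`).

WHAT IS PROVED (kernel-checked, no `sorry`, standard axioms; defs with bodies `coeff`, no `Prop`-valued named fact).
 § 1 (abstract) `coeff` (the corridor coefficient as a linear map), `single_add_update` (`B = δ_{b₀(c)}B(b₀(c)) +
     (B with b₀(c) zeroed)`), **`coeff_apply_b0_eq_neg`** (on `LQ̃B = 0`: `coeff_c(B(b₀ c)) = −(LQ̃ B^{(c)})(c)`, `B^{(c)}`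
     = `B` with the entry at `b₀(c)` set to `0` — «these variables can be expressed in terms of the remaining ones»,
     linear level; needs neither locality nor separation), `isLocal_of_bound`, and **`norm_apply_b0_le`**: under
     (L), (H), (S), `LQ̃B = 0` and `‖B(b)‖ ≤ M` at every non-distinguished bond ⇒ `‖B(b₀(c))‖ ≤ H·K·M`;
 § 2 (the cell's tori) **`norm_b0_le_of_chiFluctPrinted`**: `χ_k^{printed}(ε₁; B) = 1 ∧ LQ̃B = 0 ⇒ ‖B(b₀(c))‖ ≤ H·K·ε₁`
     for every coarse bond `c` (standing range), and **`chiFluct_eq_one_of_chiFluctPrinted`**: then the ALL-BONDS cutoff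
     of `B12SmallFieldDomain259` § 2 holds with `ε₁` replaced by `(H·K + 1)·ε₁` — the printed sentence «with the constant
     ε₁ replaced by O(ε₁)» as an implication between the two cutoffs of that module.
-/

namespace Literature.MathematicalPhysics.QuantumFieldTheory.Balaban1983to89.B12B0Restriction267

open Literature.MathematicalPhysics.QuantumFieldTheory.Balaban1983to89

/-! ## 1. Carrier-agnostic linear elimination of the distinguished variables -/

section Abstract

variable {β C 𝔤 : Type*} [DecidableEq β] [NormedAddCommGroup 𝔤] [NormedSpace ℝ 𝔤]

/-- THE CORRIDOR COEFFICIENT of a linear map `LQ̃ : (fine bond fields) → (coarse bond fields)` at the coarse bond `c`: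
`X ↦ (LQ̃ δ_{b₀(c)}X)(c)` — «a coefficient at the variable B′(b₀(c)) in (Q̃B′)(c)» (p. 267), as a linear map of `𝐠`.
[cite: Balaban1987RG1, p.267] -/
def coeff (b₀ : C → β) (Λ : (β → 𝔤) →ₗ[ℝ] (C → 𝔤)) (c : C) : 𝔤 →ₗ[ℝ] 𝔤 where
  toFun X := Λ (Pi.single (b₀ c) X) c
  map_add' X Y := by rw [Pi.single_add, map_add]; rfl
  map_smul' r X := by rw [Pi.single_smul, map_smul]; rfl

/-- `coeff` unfolded. [cite: Balaban1987RG1, p.267] -/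
theorem coeff_apply (b₀ : C → β) (Λ : (β → 𝔤) →ₗ[ℝ] (C → 𝔤)) (c : C) (X : 𝔤) :
    coeff b₀ Λ c X = Λ (Pi.single (b₀ c) X) c := rfl

omit [NormedSpace ℝ 𝔤] in
/-- A bond field splits as its distinguished entry plus the field with that entry zeroed:
`B = δ_{b}B(b) + B[b ↦ 0]`. [cite: Balaban1987RG1, p.268] -/
theorem single_add_update (B : β → 𝔤) (b : β) : Pi.single b (B b) + Function.update B b 0 = B := by
  funext x
  by_cases hx : x = b
  · subst hx; simp
  · simp [hx]

/-- **«these variables can be expressed in terms of the remaining ones»** (p. 267), linear level (p. 268 «using the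
δ-function δ(Q̃B′) we eliminate the variables B′(b₀(c))»): on the constraint surface `LQ̃B = 0`,
`coeff_c(B(b₀(c))) = −(LQ̃ B[b₀(c) ↦ 0])(c)`; when the coefficient is invertible (p. 267) this determines `B(b₀(c))`
from the remaining variables.  No locality is needed for the identity. [cite: Balaban1987RG1, p.267] -/
theorem coeff_apply_b0_eq_neg (b₀ : C → β) (Λ : (β → 𝔤) →ₗ[ℝ] (C → 𝔤)) {B : β → 𝔤} (hB : Λ B = 0) (c : C) :
    coeff b₀ Λ c (B (b₀ c)) = -(Λ (Function.update B (b₀ c) 0) c) := by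
  have h := congrArg (fun F : C → 𝔤 => F c) (congrArg Λ (single_add_update B (b₀ c)))
  simp only [map_add, Pi.add_apply, hB, Pi.zero_apply] at h
  rw [coeff_apply]
  exact eq_neg_of_add_eq_zero_left h

omit [DecidableEq β] in
/-- A quantitative locality bound implies plain locality: if `‖(LQ̃B)(c)‖ ≤ K·M` whenever `‖B‖ ≤ M` on `N(c)`, then
`(LQ̃B)(c)` depends only on `B` restricted to `N(c)` ([B7] Prop. 4 shape). [cite: Balaban1987RG1, p.267] -/
theorem isLocal_of_bound {N : C → Set β} {Λ : (β → 𝔤) →ₗ[ℝ] (C → 𝔤)} {K : ℝ}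
    (hK : ∀ (B : β → 𝔤) (c : C) (M : ℝ), (∀ b ∈ N c, ‖B b‖ ≤ M) → ‖Λ B c‖ ≤ K * M)
    {B B' : β → 𝔤} {c : C} (h : ∀ b ∈ N c, B b = B' b) : Λ B c = Λ B' c := by
  have h0 : ‖Λ (B - B') c‖ ≤ K * 0 :=
    hK (B - B') c 0 fun b hb => by rw [Pi.sub_apply, h b hb, sub_self, norm_zero]
  rw [mul_zero] at h0
  have h1 : Λ (B - B') c = 0 := norm_le_zero_iff.mp h0
  rw [map_sub, Pi.sub_apply, sub_eq_zero] at h1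
  exact h1

/-- **The rider at the linear level, carrier-agnostic**: let `LQ̃` satisfy (L) the locality bound with constant `K`
on the dependence sets `N(c)`, (H) the corridor coefficients bounded below, `‖X‖ ≤ H·‖coeff_c X‖`, and (S) the
separation «no foreign `b₀(c′)` in `N(c)`».  If `LQ̃B = 0` and `‖B(b)‖ ≤ M` at every bond that is NOT a distinguished
bond (`M ≥ 0`), then every eliminated variable satisfies `‖B(b₀(c))‖ ≤ H·K·M` («with the constant ε₁ replaced by
O(ε₁)», `O(1) = H·K`). [cite: Balaban1987RG1, (2.9) p.266] -/
theorem norm_apply_b0_le {b₀ : C → β} {N : C → Set β} {Λ : (β → 𝔤) →ₗ[ℝ] (C → 𝔤)} {K H M : ℝ}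
    (hK : ∀ (B : β → 𝔤) (c : C) (M : ℝ), (∀ b ∈ N c, ‖B b‖ ≤ M) → ‖Λ B c‖ ≤ K * M)
    (hH : ∀ (c : C) (X : 𝔤), ‖X‖ ≤ H * ‖coeff b₀ Λ c X‖) (hH0 : 0 ≤ H)
    (hsep : ∀ c c' : C, b₀ c' ∈ N c → c' = c)
    {B : β → 𝔤} (hB : Λ B = 0) (hM0 : 0 ≤ M) (hM : ∀ b : β, (¬ ∃ c : C, b₀ c = b) → ‖B b‖ ≤ M) (c : C) :
    ‖B (b₀ c)‖ ≤ H * K * M := by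
  have h1 := hH c (B (b₀ c))
  rw [coeff_apply_b0_eq_neg b₀ Λ hB c, norm_neg] at h1
  have h2 : ‖Λ (Function.update B (b₀ c) 0) c‖ ≤ K * M := by
    refine hK _ c M fun b hb => ?_
    by_cases hbb : b = b₀ c
    · subst hbb
      rw [Function.update_self, norm_zero]
      exact hM0
    · rw [Function.update_of_ne hbb]
      refine hM b ?_
      rintro ⟨c', rfl⟩
      exact hbb (congrArg b₀ (hsep c c' hb))
  calc ‖B (b₀ c)‖ ≤ H * ‖Λ (Function.update B (b₀ c) 0) c‖ := h1
    _ ≤ H * (K * M) := mul_le_mul_of_nonneg_left h2 hH0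
    _ = H * K * M := by ring

end Abstract

/-! ## 2. On the cell's tori: the printed `χ_k` and the constraint bound the eliminated variables -/

section Torus

variable {P : Params} {k : ℕ} {𝔤 : Type*} [NormedAddCommGroup 𝔤] [NormedSpace ℝ 𝔤]

open Classical in
/-- **p. 266–267 «The above restrictions imply also restrictions on B′(b₀(c)), with the constant ε₁ replaced by
O(ε₁)»** — linear level, Setup geometry (standing range `k + 1 ≤ m + K`): if the printed characteristic function
(2.9) does not vanish at `B` (all remaining variables `< ε₁`, `B12SmallFieldDomain259.chiFluctPrinted`) and `B` lies
on the linearized constraint surface `LQ̃B = 0` of a local `LQ̃` with locality bound `K` on the dependence sets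
`nbhd c` (bonds inside `B(c₋)`, inside `B(c₊)`, or in the corridor) and corridor coefficients bounded below by `H⁻¹`,
then `‖B(b₀(c))‖ ≤ H·K·ε₁` for every `c ∈ T⁽ᵏ⁺¹⁾`.  Separation is the tree's `eq_of_b0_mem_nbhd`.
[cite: Balaban1987RG1, (2.9) p.266] -/
theorem norm_b0_le_of_chiFluctPrinted (hk : k + 1 ≤ P.m + P.K)
    {Λ : VecField P k 𝔤 →ₗ[ℝ] VecField P (k+1) 𝔤} {K H ε₁ : ℝ}
    (hK : ∀ (B : VecField P k 𝔤) (c : PBond P (k+1)) (M : ℝ),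
      (∀ b ∈ B12SmallFieldDomain259.nbhd c, ‖B b‖ ≤ M) → ‖Λ B c‖ ≤ K * M)
    (hH : ∀ (c : PBond P (k+1)) (X : 𝔤), ‖X‖ ≤ H * ‖coeff B12SmallFieldDomain259.b0 Λ c X‖) (hH0 : 0 ≤ H)
    (hε₁ : 0 ≤ ε₁) {B : VecField P k 𝔤} (hχ : B12SmallFieldDomain259.chiFluctPrinted ε₁ B = 1) (hB : Λ B = 0)
    (c : PBond P (k+1)) :
    ‖B (B12SmallFieldDomain259.b0 c)‖ ≤ H * K * ε₁ := by
  have hlt : ∀ b : PBond P k, (¬ ∃ c : PBond P (k+1), B12SmallFieldDomain259.b0 c = b) → ‖B b‖ < ε₁ := by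
    by_contra hcon
    unfold B12SmallFieldDomain259.chiFluctPrinted at hχ
    rw [if_neg hcon] at hχ
    exact zero_ne_one hχ
  exact norm_apply_b0_le hK hH hH0 (fun c c' h => B12SmallFieldDomain259.eq_of_b0_mem_nbhd hk h) hB hε₁
    (fun b hb => (hlt b hb).le) c

open Classical in
/-- **The sentence as an implication between the two cutoffs of `B12SmallFieldDomain259`**: on the constraint surface,
`χ_k^{printed}(ε₁; B) = 1` implies the ALL-BONDS cutoff with `ε₁` replaced by `(H·K + 1)·ε₁` — the eliminated
variables obey the restriction with the constant `O(1)·ε₁` (`0 < ε₁`). [cite: Balaban1987RG1, (2.9) p.266] -/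
theorem chiFluct_eq_one_of_chiFluctPrinted (hk : k + 1 ≤ P.m + P.K)
    {Λ : VecField P k 𝔤 →ₗ[ℝ] VecField P (k+1) 𝔤} {K H ε₁ : ℝ}
    (hK : ∀ (B : VecField P k 𝔤) (c : PBond P (k+1)) (M : ℝ),
      (∀ b ∈ B12SmallFieldDomain259.nbhd c, ‖B b‖ ≤ M) → ‖Λ B c‖ ≤ K * M)
    (hH : ∀ (c : PBond P (k+1)) (X : 𝔤), ‖X‖ ≤ H * ‖coeff B12SmallFieldDomain259.b0 Λ c X‖) (hH0 : 0 ≤ H)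
    (hK0 : 0 ≤ K) (hε₁ : 0 < ε₁) {B : VecField P k 𝔤} (hχ : B12SmallFieldDomain259.chiFluctPrinted ε₁ B = 1)
    (hB : Λ B = 0) :
    B12SmallFieldDomain259.chiFluct ((H * K + 1) * ε₁) B = 1 := by
  have hlt : ∀ b : PBond P k, (¬ ∃ c : PBond P (k+1), B12SmallFieldDomain259.b0 c = b) → ‖B b‖ < ε₁ := by
    by_contra hcon
    unfold B12SmallFieldDomain259.chiFluctPrinted at hχ
    rw [if_neg hcon] at hχ
    exact zero_ne_one hχ
  have hall : ∀ b : PBond P k, ‖B b‖ < (H * K + 1) * ε₁ := by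
    intro b
    by_cases hb : ∃ c : PBond P (k+1), B12SmallFieldDomain259.b0 c = b
    · obtain ⟨c, rfl⟩ := hb
      have h1 := norm_b0_le_of_chiFluctPrinted hk hK hH hH0 hε₁.le hχ hB c
      have h2 : H * K * ε₁ < (H * K + 1) * ε₁ := by nlinarith
      exact lt_of_le_of_lt h1 h2
    · have h1 := hlt b hb
      have h2 : ε₁ ≤ (H * K + 1) * ε₁ := by nlinarith [mul_nonneg hH0 hK0]
      exact lt_of_lt_of_le h1 h2
  unfold B12SmallFieldDomain259.chiFluct
  rw [if_pos hall]

end Torus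

end Literature.MathematicalPhysics.QuantumFieldTheory.Balaban1983to89.B12B0Restriction267
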